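import Literature.Probability.LatticeModels.PositiveCurrentModel
import Mathlib.Topology.Algebra.InfiniteSum.ENNReal
import Mathlib.Data.ENNReal.BigOperators
import Mathlib.Logic.Equiv.Fin.Basic
import HarnessLib

/-!
# The Villain integer-current model with bondwise (inhomogeneous) stiffness

The INTEGER-CURRENT ("J-current", "worm") representation of the Villain rotor model on the
space-time torus `(ℤ/Lℤ)^d × ℤ/Mℤ`, with an arbitrary positive stiffness `κ_b > 0` on every
oriented bond `b = (s, μ) : s → s + e_μ` (requested by route
`AtomisticToContinuum/BoseEinsteinCondensation/BECVortexSheetDuality`, items `VillainCurrentLRO`,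
`HomogeneousVillainLRO`; definition item `defn-VillainCurrentModel`).  It re-uses the space-time
torus vocabulary `JCurrent.SpaceTimeSite / Dir / Bond / Config / div / wormSource` and the Villain
bond factor `PositiveCurrentModel.villainCurrentWeight β n = e^{-n²/(2β)}` of
`Literature/Probability/LatticeModels/PositiveCurrentModel.lean` (the translation-invariant,
direction-dependent closed-current models of Wallin–Sørensen–Girvin–Young 1994 §II), and adds:

* `VillainCurrentModel d L M`: the data of the model = a bondwise stiffness field
  `κ : JCurrent.Bond d L M → ℝ` with `κ_b > 0` (INHOMOGENEOUS and arbitrarily anisotropic — the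
  point of the request; the homogeneous direction-dependent case is `homogeneous β`, and agrees
  with `PositiveCurrentModel.villain β`, `currentSum_homogeneous`);
* `weight P J = ∏_b e^{-J_b²/(2κ_b)}` as an `ℝ≥0∞` (Wallin et al. 1994 §II,
  `exp{-½ ∑ K̃_ν (J^ν)²}` with `K̃ = 1/κ`; Fröhlich–Spencer 1982 §2);
* `currentSum P ρ = ∑' J, [div J = ρ] · weight P J` — the current sum with prescribed integer
  sources `ρ` (an `ℝ≥0∞`-valued `tsum` over ALL configurations `J : Bond → ℤ` of the indicator times
  the weight), `partitionFunction P = currentSum P 0`, and the worm two-point function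
  `twoPoint P x y = currentSum P (δ_x - δ_y) / partitionFunction P` for arbitrary space-time sites
  `x y` (the equal-time case is `twoPoint P (x,0) (y,0) = currentSum P (wormSource x y) / Z`,
  `twoPoint_equalTime`);
* the proved basic API: `1 ≤ Z` (`one_le_partitionFunction`, the empty configuration),
  `Z ≠ ∞` (`partitionFunction_ne_top`: `∑_J ∏_b e^{-J_b²/(2κ_b)} < ∞`, product of summable factors),
  `currentSum_neg` (`J ↦ -J`), `twoPoint_self : G(x,x) = 1`, `twoPoint_comm : G(x,y) = G(y,x)`,
  `sum_div_eq_zero : ∑_s (div J)(s) = 0` and hence `currentSum_eq_zero_of_sum_ne_zero`;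
* the coordinate form used verbatim by the route items (`Fin (d+1)` directions, `Fin.castSucc k` =
  spatial direction `k`, `Fin.last d` = imaginary time; currents and stiffnesses curried as
  `SpaceTimeSite d L M → Fin (d+1) → ℤ / ℝ`): `ofCurried κ hκ` and the unfolding theorem
  `currentSum_ofCurried`, which rewrites `currentSum` as the route's inline `tsum`, so that
  statements written with the inline sum are literally instances of this model.

## What the sources print

Wallin–Sørensen–Girvin–Young, *Phys. Rev. B* **49** (1994) 12115, §II (arXiv:cond-mat/9309035,
pp. 8–9; quoted at length in the sibling file): integrating out the angles of the Villain form of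
the quantum rotor model "enforce[s] conservation of integer-valued currents … `∂_ν J^ν = 0` … The
divergence constraint is then imposed at each site by requiring that `∑_ν J^ν_{(r,τ)} = 0`, where
`ν` runs over `±x, ±y, ±τ`" (with `J^{-x}_{(x,y,τ)} = -J^x_{(x-1,y,τ)}`), "We thus obtain
`Z ≈ ∑'_{J} exp{-½ ∑_{(r,τ)} ∑_ν K̃_ν (J^ν_{(r,τ)})²}` … the prime indicates the constraint that
`J` be everywhere divergenceless", and the Poisson summation formula
`∑_J e^{-ΔτUJ²/2} e^{iJθ} = ∑_m √(2π/ΔτU) e^{-(θ-2πm)²/(2ΔτU)}`.  Fröhlich–Spencer, *Comm. Math.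
Phys.* **83** (1982) 411, §2, (2.2)–(2.3): the Villain action `∏_b ∑_m exp(-β(dθ_b + 2πm)²/2)` and
its Fourier representation by integer-valued 1-forms.  Only the bookkeeping generalisation "one
stiffness per bond" is added here; the worm two-point function `Z(δ_x - δ_y)/Z(0)` is the
standard open-worm observable of the current representation.

## Design choices and flags

* `ℝ≥0∞`-valued sums (as requested by the route, whose items are stated in `ℝ≥0∞`): no
  summability side conditions are needed to write statements; finiteness is a theorem
  (`currentSum_ne_top`).  The bridge to the real-valued sibling is `currentSum_homogeneous`
  (`= ENNReal.ofReal` of `PositiveCurrentModel.currentSum`) in the translation-invariant case.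
* Positivity `κ_b > 0` is bundled (field `stiffness_pos`): with `κ_b ≤ 0` the Gaussian weight is
  not summable (Lean's `x / 0 = 0` would even make a `κ_b = 0` bond weightless-free), and
  `G(x,x) = 1` needs `0 < Z < ∞`.
* Finite tori need `[NeZero L] [NeZero M]` (`ZMod 0 = ℤ` is not finite).  `M = 1` (one time slice,
  `ZMod 1` trivial) is the `d`-dimensional spatial Villain model: temporal bonds are then loops
  `s → s`, drop out of `div`, and contribute the same constant factor to every `currentSum P ρ`,
  hence nothing to `twoPoint`.
* NOT here: `0 ≤ G ≤ 1` beyond `G(x,x) = 1` (the bound `Z(δ_x-δ_y) ≤ Z(0)` is `|⟨cos⟩| ≤ 1` on the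
  spin side and needs the duality); the Fourier/abelian duality with the Villain rotor Gibbs
  measure `G(x,y) = ⟨cos(θ_x - θ_y)⟩` itself (a separate file); long-range-order predicates (state
  them with `twoPoint` / `currentSum` directly, cf. `PositiveCurrentModel.HasGroundStateLRO`);
  chemical potential / complex weights; free or Dirichlet spatial boundary conditions.
* Mathlib / tree search (2026-08-15): Mathlib has no lattice current models; the tree has the
  homogeneous sibling `PositiveCurrentModel` (+ `villain β`), Ising random currents
  (`RandomCurrents`, a different object), the Villain angle kernel
  `Literature.MathematicalPhysics.QuantumFieldTheory.villainKernel` and the `U(1)₄` gauge weight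
  `zdVillainWeight`.  Nothing is redefined here.

## References

* M. Wallin, E. S. Sørensen, S. M. Girvin, A. P. Young, *Superconductor–insulator transition in
  two-dimensional dirty boson systems*, Phys. Rev. B 49 (1994) 12115–12139, §II. [WallinEtAl1994]
* J. Fröhlich, T. Spencer, *Massless phases and symmetry restoration in abelian gauge theories and
  spin systems*, Comm. Math. Phys. 83 (1982) 411–454, §2. [FrohlichSpencerCMP1982]
* A. H. Guth, Phys. Rev. D 21 (1980) 2291–2307 (the dual `U(1)` lattice gauge picture). [Guth1980]
-/

noncomputable section

open Finset Filter
open scoped ENNReal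

namespace Literature.Probability.LatticeModels

/-! ### Two more facts about the divergence on the space-time torus -/

namespace JCurrent

variable {d L M : ℕ}

/-- The worm source unfolded pointwise:
`wormSource x y z = [z = (x,0)] - [z = (y,0)]`. [folklore] -/
theorem wormSource_apply (x y : TorusSite d L) (z : SpaceTimeSite d L M) :
    (wormSource x y : SpaceTimeSite d L M → ℤ) z =
      (if z = (x, 0) then 1 else 0) - (if z = (y, 0) then 1 else 0) := by
  simp only [wormSource, Pi.sub_apply, Pi.single_apply]

variable [NeZero L] [NeZero M]

/-- On the (finite) space-time torus the total divergence of every current configuration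
vanishes: `∑_s (div J)(s) = 0` (every bond is counted once as outflow at its tail and once as
inflow at its head; re-index `s ↦ s - e_μ`). [folklore] -/
theorem sum_div_eq_zero (J : Config d L M) : ∑ s, div J s = 0 := by
  simp only [div]
  rw [Finset.sum_comm, Finset.sum_eq_zero]
  intro μ _
  rw [Finset.sum_sub_distrib, sub_eq_zero]
  exact (Fintype.sum_equiv (Equiv.subRight (unitVec μ)) _ _ fun s => rfl).symm

/-- Hence a source function with non-zero total charge is the divergence of no configuration.
[folklore] -/
theorem div_ne_of_sum_ne_zero (J : Config d L M) {ρ : SpaceTimeSite d L M → ℤ}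
    (hρ : ∑ s, ρ s ≠ 0) : div J ≠ ρ := by
  rintro rfl
  exact hρ (sum_div_eq_zero J)

end JCurrent

open JCurrent PositiveCurrentModel

/-! ### The model: a positive stiffness on every oriented bond -/

/-- The **Villain integer-current model** on the space-time torus `(ℤ/Lℤ)^d × ℤ/Mℤ` with
bondwise stiffness: the datum is a stiffness `κ_b > 0` for every positively oriented bond
`b = (s, μ) : s → s + e_μ` (`JCurrent.Bond d L M`).  Configurations are integer currents
`J : Bond → ℤ` weighted by `∏_b e^{-J_b²/(2κ_b)}` and constrained by their divergence (Wallin et al.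
1994, §II, `Z ≈ ∑'_{J} exp{-½ ∑ K̃_ν (J^ν)²}` with `K̃ = 1/κ` — there translation invariant and
direction dependent; Fröhlich–Spencer 1982 §2 for the Villain action).  The inhomogeneous,
anisotropic stiffness field is the generality requested by route BECVortexSheetDuality.
[cite: WallinEtAl1994, §II] -/
structure VillainCurrentModel (d L M : ℕ) where
  /-- The stiffness `κ_b` of the oriented bond `b = (s, μ)`. -/
  stiffness : JCurrent.Bond d L M → ℝ
  /-- Every stiffness is positive. -/
  stiffness_pos : ∀ b, 0 < stiffness b

namespace VillainCurrentModel

variable {d L M : ℕ}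

/-- The **homogeneous** (translation-invariant, direction-dependent) Villain current model with
stiffness `β_μ > 0` in direction `μ` on every bond — the case printed by Wallin et al. 1994, §II
(`β_space = 1/K̃_x`, `β_time = 1/K̃_τ`) and by `PositiveCurrentModel.villain β`.
[cite: WallinEtAl1994, §II] -/
def homogeneous (β : Dir d → ℝ) (hβ : ∀ μ, 0 < β μ) : VillainCurrentModel d L M where
  stiffness b := β b.2
  stiffness_pos b := hβ b.2

/-- The stiffness field of `homogeneous β` unfolded. [folklore] -/
@[simp] theorem homogeneous_stiffness (β : Dir d → ℝ) (hβ : ∀ μ, 0 < β μ) (b : Bond d L M) :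
    (homogeneous β hβ : VillainCurrentModel d L M).stiffness b = β b.2 := rfl

section FiniteVolume

variable [NeZero L] [NeZero M] (P : VillainCurrentModel d L M)

/-! ### Weights -/

/-- The **Villain weight** of a current configuration, `W(J) = ∏_b e^{-J_b²/(2κ_b)} ∈ ℝ≥0∞`
(product over all positively oriented bonds; Wallin et al. 1994 §II,
`exp{-½ ∑_{(r,τ)} ∑_ν K̃_ν (J^ν_{(r,τ)})²}`). [cite: WallinEtAl1994, §II] -/
def weight (J : Config d L M) : ℝ≥0∞ :=
  ∏ b, ENNReal.ofReal (villainCurrentWeight (P.stiffness b) (J b))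

/-- `W(J)` unfolded with the exponential written out: `∏_b ofReal (exp (-(J_b)²/(2κ_b)))`.
[folklore] -/
theorem weight_eq (J : Config d L M) :
    P.weight J = ∏ b, ENNReal.ofReal (Real.exp (-((J b : ℝ) ^ 2) / (2 * P.stiffness b))) := rfl

/-- `W(J) = ofReal (∏_b e^{-J_b²/(2κ_b)})` (the real-valued product of the sibling file).
[folklore] -/
theorem weight_eq_ofReal_prod (J : Config d L M) :
    P.weight J = ENNReal.ofReal (∏ b, villainCurrentWeight (P.stiffness b) (J b)) := by
  rw [weight, ENNReal.ofReal_prod_of_nonneg fun b _ => (villainCurrentWeight_pos _ _).le]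

/-- The empty configuration has weight `1`. [folklore] -/
@[simp] theorem weight_zero : P.weight (0 : Config d L M) = 1 := by
  simp [weight]

/-- `W(-J) = W(J)`. [folklore] -/
@[simp] theorem weight_neg (J : Config d L M) : P.weight (-J) = P.weight J := by
  simp only [weight, Pi.neg_apply, villainCurrentWeight_neg]

/-- `W(J) ≠ ∞` (a finite product of real numbers). [folklore] -/
theorem weight_ne_top (J : Config d L M) : P.weight J ≠ ∞ := by
  rw [weight_eq_ofReal_prod]
  exact ENNReal.ofReal_ne_top

/-- `W(J) ≠ 0` (every factor is an exponential). [folklore] -/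
theorem weight_ne_zero (J : Config d L M) : P.weight J ≠ 0 := by
  rw [weight, Finset.prod_ne_zero_iff]
  intro b _
  exact (ENNReal.ofReal_pos.2 (villainCurrentWeight_pos _ _)).ne'

/-- `W(J) ≤ 1`: with positive stiffness every factor `e^{-J_b²/(2κ_b)}` is at most `1`. [folklore] -/
theorem weight_le_one (J : Config d L M) : P.weight J ≤ 1 := by
  refine Finset.prod_le_one' fun b _ => ENNReal.ofReal_le_one.2 ?_
  rw [villainCurrentWeight, Real.exp_le_one_iff, neg_div]
  exact neg_nonpos.2 (div_nonneg (sq_nonneg _) (by linarith [P.stiffness_pos b]))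

/-- `∑_J W(J) < ∞` over ALL configurations: `∑_{J : Bond → ℤ} ∏_b e^{-J_b²/(2κ_b)}
= ∏_b ∑_n e^{-n²/(2κ_b)}`-type bound (product of summable non-negative factors,
`summable_pi_prod_of_summable'`). [folklore] -/
theorem tsum_weight_ne_top : ∑' J : Config d L M, P.weight J ≠ ∞ := by
  have hs : Summable fun J : Config d L M => ∏ b, villainCurrentWeight (P.stiffness b) (J b) :=
    summable_pi_prod_of_summable' (fun b : Bond d L M => villainCurrentWeight (P.stiffness b))
      (fun b n => (villainCurrentWeight_pos _ n).le)
      fun b => summable_villainCurrentWeight (P.stiffness_pos b)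
  simp_rw [weight_eq_ofReal_prod]
  rw [← ENNReal.ofReal_tsum_of_nonneg
    (fun J => Finset.prod_nonneg fun b _ => (villainCurrentWeight_pos _ _).le) hs]
  exact ENNReal.ofReal_ne_top

/-! ### Current sums with prescribed sources, partition function -/

/-- The **current sum with prescribed integer sources** `ρ`:
`Z(ρ) = ∑_{J : div J = ρ} ∏_b e^{-J_b²/(2κ_b)} ∈ ℝ≥0∞`, written as the `tsum` over all
configurations of the indicator of `div J = ρ` times the weight (Wallin et al. 1994 §II: the primed
sum "indicates the constraint that `J` be everywhere divergenceless", here with a general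
right-hand side `ρ`; `ρ = δ_x - δ_y` inserts an open worm from `x` to `y`).
[cite: WallinEtAl1994, §II] -/
def currentSum (ρ : SpaceTimeSite d L M → ℤ) : ℝ≥0∞ :=
  ∑' J : Config d L M, if div J = ρ then P.weight J else 0

/-- The **partition function** `Z = Z(0) = ∑_{div J = 0} ∏_b e^{-J_b²/(2κ_b)}` of the closed-current
model (Wallin et al. 1994 §II, `Z ≈ ∑'_{J} exp{-½ ∑ K̃_ν (J^ν)²}`). [cite: WallinEtAl1994, §II] -/
def partitionFunction : ℝ≥0∞ := P.currentSum 0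

/-- `Z(ρ) ≤ ∑_J W(J)`. [folklore] -/
theorem currentSum_le_tsum_weight (ρ : SpaceTimeSite d L M → ℤ) :
    P.currentSum ρ ≤ ∑' J : Config d L M, P.weight J := by
  refine ENNReal.tsum_le_tsum fun J => ?_
  split_ifs
  · exact le_rfl
  · exact bot_le

/-- `Z(ρ) < ∞` for every source function. [folklore] -/
theorem currentSum_ne_top (ρ : SpaceTimeSite d L M → ℤ) : P.currentSum ρ ≠ ∞ :=
  ne_top_of_le_ne_top P.tsum_weight_ne_top (P.currentSum_le_tsum_weight ρ)

/-- Reversing the sources does not change the current sum, `Z(-ρ) = Z(ρ)` (substitute `J ↦ -J`).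
[folklore] -/
theorem currentSum_neg (ρ : SpaceTimeSite d L M → ℤ) : P.currentSum (-ρ) = P.currentSum ρ := by
  unfold currentSum
  conv_lhs => rw [← (Equiv.neg (Config d L M)).tsum_eq]
  refine tsum_congr fun J => ?_
  simp only [Equiv.neg_apply, div_neg, neg_inj, weight_neg]

/-- A source function with non-zero total charge carries no current: `∑_s ρ(s) ≠ 0 → Z(ρ) = 0`
(e.g. a single worm end `ρ = δ_x`). [folklore] -/
theorem currentSum_eq_zero_of_sum_ne_zero {ρ : SpaceTimeSite d L M → ℤ} (hρ : ∑ s, ρ s ≠ 0) :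
    P.currentSum ρ = 0 := by
  unfold currentSum
  rw [ENNReal.tsum_eq_zero]
  intro J
  rw [if_neg (div_ne_of_sum_ne_zero J hρ)]

/-- `1 ≤ Z`: the empty configuration is divergence free and has weight `1`. [folklore] -/
theorem one_le_partitionFunction : 1 ≤ P.partitionFunction := by
  unfold partitionFunction currentSum
  refine le_trans ?_ (ENNReal.le_tsum (0 : Config d L M))
  simp

/-- `Z ≠ 0`. [folklore] -/
theorem partitionFunction_ne_zero : P.partitionFunction ≠ 0 :=
  (lt_of_lt_of_le one_pos P.one_le_partitionFunction).ne'

/-- `Z ≠ ∞`. [folklore] -/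
theorem partitionFunction_ne_top : P.partitionFunction ≠ ∞ := P.currentSum_ne_top 0

/-! ### The worm two-point function -/

/-- The **worm two-point function** `G(x, y) = Z(δ_x - δ_y) / Z(0)` between two space-time sites:
one unit of current is injected at `x` and extracted at `y`.  Under the Fourier (abelian) duality
with the Villain rotor model this is the spin–spin correlation `⟨cos(θ_x - θ_y)⟩` (Wallin et al.
1994 §II; Fröhlich–Spencer 1982 §2); that identity is NOT part of this definition.
[cite: WallinEtAl1994, §II] -/
def twoPoint (x y : SpaceTimeSite d L M) : ℝ≥0∞ :=
  P.currentSum (Pi.single x 1 - Pi.single y 1) / P.partitionFunction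

/-- The equal-time two-point function is the current sum with the sibling file's `wormSource`:
`G((x,0),(y,0)) = Z(wormSource x y) / Z`. [folklore] -/
theorem twoPoint_equalTime (x y : TorusSite d L) :
    P.twoPoint (x, 0) (y, 0) = P.currentSum (wormSource x y) / P.partitionFunction := rfl

/-- `G(x, x) = 1` (uses `0 < Z < ∞`). [folklore] -/
@[simp] theorem twoPoint_self (x : SpaceTimeSite d L M) : P.twoPoint x x = 1 := by
  unfold twoPoint
  rw [sub_self]
  exact ENNReal.div_self P.partitionFunction_ne_zero P.partitionFunction_ne_top

/-- `G(x, y) = G(y, x)` (by the `J ↦ -J` symmetry, `currentSum_neg`). [folklore] -/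
theorem twoPoint_comm (x y : SpaceTimeSite d L M) : P.twoPoint x y = P.twoPoint y x := by
  unfold twoPoint
  rw [← neg_sub (Pi.single x 1) (Pi.single y 1), currentSum_neg]

/-- `G(x, y) < ∞`. [folklore] -/
theorem twoPoint_ne_top (x y : SpaceTimeSite d L M) : P.twoPoint x y ≠ ∞ :=
  ENNReal.div_ne_top (P.currentSum_ne_top _) P.partitionFunction_ne_zero

/-- Block sums of the two-point function versus block sums of current sums (the form in which
long-range order is stated): `∑_{x,y} G((x,0),(y,0)) = (∑_{x,y} Z(wormSource x y)) / Z`.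
[folklore] -/
theorem sum_twoPoint_equalTime :
    ∑ x : TorusSite d L, ∑ y : TorusSite d L, P.twoPoint (x, 0) (y, 0) =
      (∑ x : TorusSite d L, ∑ y : TorusSite d L, P.currentSum (wormSource x y)) /
        P.partitionFunction := by
  simp only [twoPoint_equalTime, div_eq_mul_inv, Finset.sum_mul]

/-! ### The homogeneous case is the sibling file's real-valued Villain model -/

/-- For direction-dependent constant stiffness `β`, the weight is `ofReal` of
`(PositiveCurrentModel.villain β).bondWeight`. [folklore] -/
theorem weight_homogeneous (β : Dir d → ℝ) (hβ : ∀ μ, 0 < β μ) (J : Config d L M) :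
    (homogeneous β hβ : VillainCurrentModel d L M).weight J =
      ENNReal.ofReal ((villain β hβ).bondWeight J) := by
  rw [weight_eq_ofReal_prod]
  rfl

/-- **Consistency with `PositiveCurrentModel.villain`**: in the homogeneous case every current sum
is `ENNReal.ofReal` of the real-valued current sum of the sibling file,
`Z_κ(ρ) = ofReal (∑_{div J = ρ} ∏_b e^{-J_b²/(2β_{μ(b)})})`. [folklore] -/
theorem currentSum_homogeneous (β : Dir d → ℝ) (hβ : ∀ μ, 0 < β μ)
    (ρ : SpaceTimeSite d L M → ℤ) :
    (homogeneous β hβ : VillainCurrentModel d L M).currentSum ρ =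
      ENNReal.ofReal ((villain β hβ).currentSum ρ) := by
  rw [PositiveCurrentModel.currentSum, ENNReal.ofReal_tsum_of_nonneg
    ((villain β hβ).currentSummand_nonneg ρ) ((villain β hβ).summable_currentSummand ρ)]
  refine tsum_congr fun J => ?_
  rw [weight_homogeneous]
  split_ifs
  · rfl
  · exact ENNReal.ofReal_zero.symm

/-- In particular the homogeneous two-point function is `ofReal` of
`PositiveCurrentModel.twoPoint`. [folklore] -/
theorem twoPoint_homogeneous (β : Dir d → ℝ) (hβ : ∀ μ, 0 < β μ) (x y : TorusSite d L) :
    (homogeneous β hβ : VillainCurrentModel d L M).twoPoint (x, 0) (y, 0) =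
      ENNReal.ofReal ((villain β hβ).twoPoint L M x y) := by
  rw [twoPoint_equalTime, currentSum_homogeneous, partitionFunction, currentSum_homogeneous,
    PositiveCurrentModel.twoPoint, ENNReal.ofReal_div_of_pos ((villain β hβ).partitionFunction_pos L M)]
  rfl

end FiniteVolume

/-! ### Coordinates: directions `Fin (d+1)`, curried currents and stiffnesses

The route items write a bond as `(s, i)` with `i : Fin (d+1)`, `Fin.castSucc k` being the spatial
direction `k : Fin d` (backward neighbour `(s.1 - e_k, s.2)`) and `Fin.last d` the imaginary-time
direction (backward neighbour `(s.1, s.2 - 1)`), and curry `J`, `κ` as `S → Fin (d+1) → _`.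
`finSuccEquivLast : Fin (d+1) ≃ Option (Fin d)` (`castSucc k ↦ some k`, `last ↦ none`) is exactly
the dictionary with `JCurrent.Dir d`. -/

section Coordinates

variable {d L M : ℕ}

/-- Curried coordinates for functions on bonds: `J ↦ fun s i => J (s, finSuccEquivLast i)`,
an equivalence `(Bond d L M → α) ≃ (SpaceTimeSite d L M → Fin (d+1) → α)`. [folklore] -/
def curryEquiv (α : Type*) : (Bond d L M → α) ≃ (SpaceTimeSite d L M → Fin (d + 1) → α) :=
  (Equiv.curry _ _ _).trans
    (Equiv.piCongrRight fun _ => Equiv.arrowCongr finSuccEquivLast.symm (Equiv.refl α))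

/-- `curryEquiv` unfolded. [folklore] -/
@[simp] theorem curryEquiv_apply {α : Type*} (J : Bond d L M → α) (s : SpaceTimeSite d L M)
    (i : Fin (d + 1)) : curryEquiv α J s i = J (s, finSuccEquivLast i) := rfl

/-- `curryEquiv.symm` unfolded. [folklore] -/
@[simp] theorem curryEquiv_symm_apply {α : Type*} (J : SpaceTimeSite d L M → Fin (d + 1) → α)
    (b : Bond d L M) : (curryEquiv α).symm J b = J b.1 (finSuccEquivLast.symm b.2) := rfl

/-- The Villain current model with a curried stiffness field `κ : S → Fin (d+1) → ℝ`, `κ > 0`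
(coordinates as in the section docstring). [folklore] -/
def ofCurried (κ : SpaceTimeSite d L M → Fin (d + 1) → ℝ) (hκ : ∀ s i, 0 < κ s i) :
    VillainCurrentModel d L M where
  stiffness b := κ b.1 (finSuccEquivLast.symm b.2)
  stiffness_pos _ := hκ _ _

/-- The stiffness of `ofCurried κ hκ` unfolded. [folklore] -/
@[simp] theorem ofCurried_stiffness (κ : SpaceTimeSite d L M → Fin (d + 1) → ℝ)
    (hκ : ∀ s i, 0 < κ s i) (b : Bond d L M) :
    (ofCurried κ hκ).stiffness b = κ b.1 (finSuccEquivLast.symm b.2) := rfl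

/-- The route's inline worm source is `wormSource`: for spatial sites `x y`,
`(fun z => [z = (x,0)] - [z = (y,0)]) = wormSource x y`. [folklore] -/
theorem inlineSource_eq_wormSource (x y : TorusSite d L) :
    (fun z : SpaceTimeSite d L M => (if z = (x, 0) then (1 : ℤ) else 0) - (if z = (y, 0) then 1 else 0)) =
      wormSource x y :=
  funext fun z => (wormSource_apply x y z).symm

/-- The divergence in coordinates: for a curried current `J`,
`div J (s) = ∑_{k : Fin d} (J s k⁺ - J (s.1 - e_k, s.2) k⁺) + (J s last - J (s.1, s.2 - 1) last)`
(`k⁺ = Fin.castSucc k`). [folklore] -/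
theorem div_curryEquiv_symm (J : SpaceTimeSite d L M → Fin (d + 1) → ℤ)
    (s : SpaceTimeSite d L M) :
    div ((curryEquiv ℤ).symm J) s =
      (∑ k : Fin d, (J s k.castSucc - J (s.1 - Pi.single k 1, s.2) k.castSucc)) +
        (J s (Fin.last d) - J (s.1, s.2 - 1) (Fin.last d)) := by
  have hsum : ∑ μ : Dir d, ((curryEquiv ℤ).symm J (s, μ) - (curryEquiv ℤ).symm J (s - unitVec μ, μ)) =
      ∑ i : Fin (d + 1), (J s i - J (s - unitVec (finSuccEquivLast i)) i) :=
    (Fintype.sum_equiv finSuccEquivLast _ _ fun i => by simp).symm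
  have hk : ∀ k : Fin d, s - (unitVec (some k) : SpaceTimeSite d L M) = (s.1 - Pi.single k 1, s.2) :=
    fun k => Prod.ext (by simp [unitVec]) (by simp [unitVec])
  have hl : s - (unitVec none : SpaceTimeSite d L M) = (s.1, s.2 - 1) :=
    Prod.ext (by simp [unitVec]) (by simp [unitVec])
  rw [div, hsum, Fin.sum_univ_castSucc]
  congr 1
  · refine Finset.sum_congr rfl fun k _ => ?_
    rw [finSuccEquivLast_castSucc, hk k]
  · rw [finSuccEquivLast_last, hl]

variable [NeZero L] [NeZero M]

/-- The weight in coordinates: `W = ∏_s ∏_{i : Fin (d+1)} e^{-(J s i)²/(2 κ s i)}`. [folklore] -/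
theorem weight_ofCurried_curryEquiv_symm (κ : SpaceTimeSite d L M → Fin (d + 1) → ℝ)
    (hκ : ∀ s i, 0 < κ s i) (J : SpaceTimeSite d L M → Fin (d + 1) → ℤ) :
    (ofCurried κ hκ).weight ((curryEquiv ℤ).symm J) =
      ∏ s, ∏ i, ENNReal.ofReal (Real.exp (-((J s i : ℝ) ^ 2 / (2 * κ s i)))) := by
  rw [weight, Fintype.prod_prod_type]
  refine Finset.prod_congr rfl fun s _ => ?_
  refine Fintype.prod_equiv finSuccEquivLast.symm _ _ fun μ => ?_
  simp only [curryEquiv_symm_apply, ofCurried_stiffness, villainCurrentWeight, neg_div]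

/-- **The route's inline form.**  For a curried positive stiffness field `κ`, every current sum of
`ofCurried κ hκ` is the `ℝ≥0∞`-`tsum`, over curried currents `J : S → Fin (d+1) → ℤ`, of the
indicator of the coordinate divergence condition times `∏_s ∏_i e^{-(J s i)²/(2 κ s i)}` — verbatim
the expression inlined in items `VillainCurrentLRO` / `HomogeneousVillainLRO` of route
BECVortexSheetDuality (there `d = 3`, `L = M+1`, `M = T+1`). [folklore] -/
theorem currentSum_ofCurried (κ : SpaceTimeSite d L M → Fin (d + 1) → ℝ) (hκ : ∀ s i, 0 < κ s i)
    (ρ : SpaceTimeSite d L M → ℤ) :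
    (ofCurried κ hκ).currentSum ρ =
      ∑' J : SpaceTimeSite d L M → Fin (d + 1) → ℤ,
        if (∀ s, (∑ k : Fin d, (J s k.castSucc - J (s.1 - Pi.single k 1, s.2) k.castSucc)) +
              (J s (Fin.last d) - J (s.1, s.2 - 1) (Fin.last d)) = ρ s)
        then ∏ s, ∏ i, ENNReal.ofReal (Real.exp (-((J s i : ℝ) ^ 2 / (2 * κ s i)))) else 0 := by
  rw [currentSum, ← (curryEquiv ℤ).symm.tsum_eq]
  refine tsum_congr fun J => ?_
  have hdiv : div ((curryEquiv ℤ).symm J) = ρ ↔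
      ∀ s, (∑ k : Fin d, (J s k.castSucc - J (s.1 - Pi.single k 1, s.2) k.castSucc)) +
        (J s (Fin.last d) - J (s.1, s.2 - 1) (Fin.last d)) = ρ s := by
    simp only [funext_iff, div_curryEquiv_symm]
  rw [weight_ofCurried_curryEquiv_symm]
  exact if_congr hdiv rfl rfl

end Coordinates

end VillainCurrentModel

end Literature.Probability.LatticeModels
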